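import Summits.BirchSwinnertonDyer.BirchSwinnertonDyer.Theses.KolyvaginRankRigidityAtTwo
import Summits.BirchSwinnertonDyer.BirchSwinnertonDyer.Theorems.KolyvaginRankRigidityAtTwoKolyvaginCorankLowerBoundAtTwoThetaGlobalOrderLevelUp
import Summits.BirchSwinnertonDyer.BirchSwinnertonDyer.Theorems.KolyvaginRankRigidityAtTwoKolyvaginCorankLowerBoundAtTwoMarginChebotarevOneClassIndexAtTwo
import HarnessLib

/-!
# Crux U2 `FullClassDeepeningAtTwo` (stmt-BirchSwinnertonDyer-28084; LINE 14 of pen bsd-idea-1 g7, transport half of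
# V1′∞ 27983) — BY NAME from the landed swap engine, modulo the LOSSY prime swap S1L (displayed)

Width seat `bsd-line-krr2-p2` g8 (route `KolyvaginRankRigidityAtTwo`). U2 says: on the V1′∞ frame there is a constant `c`
such that every NEARLY FULL Kolyvagin class — `2^(M−m−1)·c_M(n) ≠ 0`, `n` of depth `r` with `M ≤ M(n)`, `c·(m+r+1) ≤ M` —
can be moved to a conductor `n'` of the SAME depth all of whose primes have index `≥ θ·M' + k` (any `θ, k`), with
`c_{M'}(n') ≠ 0`, `1 ≤ M'`. Proof (the SEED PHASE of the lead's `windowsRich_of_lossySwapTest`, made a theorem):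
* one level DOWN, `L := M − 1` (S1L wants index `≥ L + 1`, U2 gives `≥ M`): `ι_* c_L(n) = 2·c_M(n)`
  (`torsionH1OfDvd_kolyvaginClass_two_pow`, McCallum §4 (4)–(6)) gives `2^(M−m−2)·c_L(n) ≠ 0` — no injectivity needed
  (`pow_smul_kolyvaginClass_pred_ne_zero`);
* S2 `stub_chebotarevOneClassIndexAtTwo` (c₁; p621465) turns global into local largeness `2^(j₀)·c_L ∉ ker loc_λ` at fresh
  Kolyvagin primes of index `≥ I := θ·L + k + L + 1` outside any finite set, `j₀ = M − m − 2 − c₁`;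
* `r` lossy swaps at level `L` (S1L, output exponent `j − c₂`; precondition `L + c₀ ≤ 2 (j₀ − r c₂)` ⇐ `c (m+r+1) ≤ M` with
  `c := c₀ + 2c₁ + 2c₂ + 3`) replace the primes of `n` one at a time by fresh primes of index `≥ I` (`seedWalk`);
* read off: `n' = ∏ T'` square-free on Kolyvagin primes of index `≥ I ≥ θ L + k`, depth `r`, `M' := L ≥ 1`, `c_L(n') ≠ 0`.
`fullClassDeepeningAtTwo_of_lossySwap` displays S1L (text of `stub_primeSwapAtTwoLossy` VERBATIM) as a hypothesis; the
sequel file `…FullClassDeepeningAtTwoOfNamedFacts` discharges it by the lead's `primeSwapAtTwoLossy_of_namedFacts` (p640628),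
leaving Gross 1991 Prop. 3.7 (2) (`GrossLMS1991.prop37_2_frobeniusCongruence`, cite-only in the tree) as the only input.
HONEST FRAMING: CONDITIONAL on `hS1L` (D-0014); U1 `KolyvaginBoundedDefectAtTwo` (Kolyvagin's conjecture at 2) is NOT
touched; no summit, rung or BSD statement is proved by any of this.
References: Kolyvagin, Math. Ann. 291 (1991) §2 (Prop. 8 propagation); McCallum, LMS 153 (1991) §4 (4)–(6), §5 Prop. 5.2;
Gross, LMS 153 (1991) Prop. 3.7 (2); W. Zhang, Camb. J. Math. 2 (2014) Lemma 8.4.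
-/

set_option autoImplicit false
-- the Theorems namespace of this sub repeats the summit name by design (D-0017 nested layout)
set_option linter.dupNamespace false

noncomputable section

open scoped Classical

open WeierstrassCurve Field Literature.NumberTheory.EllipticCurves
  Literature.NumberTheory.EllipticCurves.ModularForms NumberField IsDedekindDomain
  Literature.NumberTheory.EllipticCurves.KolyvaginCocycle
  Literature.NumberTheory.GaloisRepresentations
open Summit.BirchSwinnertonDyer.BirchSwinnertonDyer.Theses.KolyvaginRankRigidityAtTwo

namespace Summit.BirchSwinnertonDyer.BirchSwinnertonDyer.Theorems.KolyvaginLowerBoundAtTwo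

/-! ## Bookkeeping on products of distinct primes -/

/-- The prime factors of a product of distinct primes. [folklore] -/
private theorem primeFactors_prod_primes₂ {s : Finset ℕ} (hs : ∀ p ∈ s, p.Prime) :
    (∏ p ∈ s, p).primeFactors = s :=
  Nat.primeFactors_prod hs

/-- A product of distinct primes is square-free. [folklore] -/
private theorem squarefree_prod_primes₂ {s : Finset ℕ} (hs : ∀ p ∈ s, p.Prime) :
    Squarefree (∏ p ∈ s, p) := by
  refine Finset.squarefree_prod_of_pairwise_isCoprime (fun a ha b hb hab ↦ ?_)
    fun p hp ↦ (hs p hp).squarefree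
  simp only [← Nat.coprime_iff_isRelPrime]
  exact (Nat.coprime_primes (hs a ha) (hs b hb)).mpr hab

/-- Transport of a datum along an equality of conductors keeps its classes. [folklore] -/
private theorem kolyvaginClass_cast₂ {W : WeierstrassCurve ℚ} [W.IsGloballyMinimal] {K : Type}
    [Field K] [NumberField K] [NeZero (W.conductorNorm ℤ)]
    {Dt : ModularParametrizationData W (W.conductorNorm ℤ)} {β : ℤ} {ι : K →+* ℂ} {n n' : ℕ}
    (e : n = n') (d : KolyvaginHeegnerData Dt β ι n) (M : ℕ) :
    (e ▸ d).kolyvaginClass Nat.prime_two M = d.kolyvaginClass Nat.prime_two M := by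
  subst e; rfl

/-! ## One level down -/

/-- **One level DOWN keeps fullness**: on the habitat, for a Kolyvagin conductor `n` with `M ≤ M(n)`,
`2^(e+1)·c_M(n) ≠ 0 ⇒ 2^e·c_{M−1}(n) ≠ 0`, because `ι_* c_{M−1}(n) = 2·c_M(n)` for the change-of-level map
`ι_* : H¹(K, E[2^(M−1)]) → H¹(K, E[2^M])` (McCallum 1991 §4 (4)–(6); tree `torsionH1OfDvd_kolyvaginClass_two_pow`, whose
standing inputs — admissibility at `2` and invariance of `[P(n)]` — are theorems on the habitat). No injectivity is used.
[cite: McCallumLMS1991, §4 (4)–(6), Lemma 4.6] [cite: GrossLMS1991, Prop. 3.6, Lemma 4.3] -/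
theorem pow_smul_kolyvaginClass_pred_ne_zero (W : WeierstrassCurve ℚ) [W.IsElliptic] [W.IsGloballyMinimal]
    (hsur : ∀ m : ℕ, W.HasSurjectiveModNGaloisRep (2 ^ m : ℕ))
    (K : Type) [Field K] [NumberField K] (hK : IsImaginaryQuadratic K) (hne3 : NumberField.discr K ≠ -3)
    (hne4 : NumberField.discr K ≠ -4) (hodd : Odd (NumberField.discr K)) [NeZero (W.conductorNorm ℤ)]
    (hHN : SatisfiesHeegnerHypothesis (W.conductorNorm ℤ) K)
    (Dt : ModularParametrizationData W (W.conductorNorm ℤ)) (β : ℤ) (ι : K →+* ℂ)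
    {n : ℕ} (dat : KolyvaginHeegnerData Dt β ι n) {M e : ℕ}
    (hn : KolyvaginDescent.KolSupp (Zhang2014.IsKolyvaginPrime (W.conductorNorm ℤ) W K 2) n) (hM : 1 ≤ M)
    (hlev : (M : ℕ∞) ≤ Zhang2014.levelIndex W 2 n)
    (hne : ((2 ^ (e + 1) : ℕ) : ℤ) • dat.kolyvaginClass Nat.prime_two M ≠ 0) :
    ((2 ^ e : ℕ) : ℤ) • dat.kolyvaginClass Nat.prime_two (M - 1) ≠ 0 := by
  have hD : NumberField.discr K < -4 :=
    Summit.BirchSwinnertonDyer.Rank1Residual.X11b.KolyvaginAssembly.discr_lt_neg_four hK ⟨hne3, hne4⟩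
  have hs2 : W.HasSurjectiveModNGaloisRep 2 := by simpa using hsur 1
  have hn0 : n ≠ 0 := hn.1.ne_zero
  -- the class at level `M` is McCallum's class (it is non-zero)
  have hne0 : dat.kolyvaginClass Nat.prime_two M ≠ 0 := fun h ↦ hne (by rw [h, zsmul_zero])
  obtain ⟨hA', hP'⟩ := dat.kolyvaginClass_ne_zero hne0
  -- the standing inputs at level `M - 1` on the habitat
  have hA : IsAdmissible (absoluteGaloisGroup K) dat.pointsSubgroup ((2 ^ (M - 1) : ℕ) : ℤ) :=
    KolyvaginAtTwo.isAdmissible_pointsSubgroup_two_of_heegner dat hs2 hK hodd hHN hn0 (M - 1)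
  have hkol : ∀ q ∈ n.primeFactors, Zhang2014.IsKolyvaginPrime (W.conductorNorm ℤ) W K 2 q ∧
      M - 1 ≤ Zhang2014.kolyvaginIndex W 2 q :=
    fun q hq ↦ ⟨hn.2 q hq, le_trans (Nat.sub_le M 1) ((Zhang2014.natCast_le_levelIndex_iff.mp hlev) q hq)⟩
  have hP : dat.toGeomPoints dat.derivedPoint ∈
      invPoints (absoluteGaloisGroup K) dat.pointsSubgroup ((2 ^ (M - 1) : ℕ) : ℤ) :=
    Prop44.toGeomPoints_derivedPoint_mem_invPoints hK ι hD hHN Dt Nat.prime_two hn.1 hkol dat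
  -- `ι_* (2^e c_{M-1}) = 2^e · 2 · c_M = 2^(e+1) c_M`
  have hid := torsionH1OfDvd_kolyvaginClass_two_pow dat (Nat.sub_le M 1) hA hP hA' hP'
  have hMM : M - (M - 1) = 1 := by omega
  rw [hMM, pow_one] at hid
  intro h0
  apply hne
  have h := congrArg (torsionH1OfDvd (W.baseChange K)
    (by exact_mod_cast pow_dvd_pow 2 (Nat.sub_le M 1) : ((2 ^ (M - 1) : ℕ) : ℤ) ∣ ((2 ^ M : ℕ) : ℤ))) h0
  rw [map_zsmul, map_zero, hid, smul_smul, ← Nat.cast_mul, ← pow_succ] at h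
  exact h

/-! ## The seed walk: replace the primes of a window one at a time by fresh deep primes (level `L`) -/

section Walk

variable (W : WeierstrassCurve ℚ) [W.IsGloballyMinimal] (K : Type) [Field K] [NumberField K]
  [NeZero (W.conductorNorm ℤ)]
  (Dt : ModularParametrizationData W (W.conductorNorm ℤ)) (β : ℤ) (ι : K →+* ℂ)

/-- **The seed walk at a fixed level `L`** (Kolyvagin's propagation, [1] Prop. 8, LOSSY form): from a window `T ⊇ T ∩ T₀` of
`r` Kolyvagin primes of index `≥ L + 1` whose primes outside `T₀` have index `≥ I`, with `cc` old primes (`∈ T₀`) left and a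
class that is `2^(j − (r − cc)·c₂)`-large at fresh primes of index `≥ I`, the lossy swap `hswap` (precondition
`L + c₀ ≤ 2·(exponent)`) removes the old primes one by one; at the end all `r` primes have index `≥ I` and the class is
`2^(j − r·c₂)`-large. (The `walk` inside the lead's `windowsRich_of_lossySwapTest`, p623984, as a theorem.)
[cite: Kolyvagin1991MathAnn, §2 (Prop. 8 of [1]), p. 257] [cite: McCallumLMS1991, §5 Prop. 5.2] -/
theorem seedWalk (c₀ c₂ L I j r : ℕ) (T₀ : Finset ℕ) (hLI : L + 1 ≤ I)
    (hswap : ∀ (T : Finset ℕ) (a : ℕ) (dat : KolyvaginHeegnerData Dt β ι (∏ p ∈ T, p)) (j : ℕ) (X : Finset ℕ),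
      (∀ p ∈ T, Zhang2014.IsKolyvaginPrime (W.conductorNorm ℤ) W K 2 p ∧
        L + 1 ≤ Zhang2014.kolyvaginIndex W 2 p) →
      a ∈ T → L + c₀ ≤ 2 * j →
      (∀ X' : Finset ℕ, ∃ q : ℕ, q ∉ X' ∧ Zhang2014.IsKolyvaginPrime (W.conductorNorm ℤ) W K 2 q ∧
        I ≤ Zhang2014.kolyvaginIndex W 2 q ∧
        ∃ v : HeightOneSpectrum (𝓞 K), ((q : ℕ) : 𝓞 K) ∈ v.asIdeal ∧
          ((2 ^ j : ℕ) : ℤ) • dat.kolyvaginClass Nat.prime_two L ∉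
            (W.baseChange K).torsionLocalKer (v.adicCompletion K) ((2 ^ L : ℕ) : ℤ)) →
      ∃ ℓ : ℕ, ℓ ∉ X ∧ ℓ ∉ T ∧ Zhang2014.IsKolyvaginPrime (W.conductorNorm ℤ) W K 2 ℓ ∧
        I ≤ Zhang2014.kolyvaginIndex W 2 ℓ ∧
        ∃ dat' : KolyvaginHeegnerData Dt β ι (∏ p ∈ insert ℓ (T.erase a), p),
          ∀ X' : Finset ℕ, ∃ q : ℕ, q ∉ X' ∧ Zhang2014.IsKolyvaginPrime (W.conductorNorm ℤ) W K 2 q ∧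
            I ≤ Zhang2014.kolyvaginIndex W 2 q ∧
            ∃ v : HeightOneSpectrum (𝓞 K), ((q : ℕ) : 𝓞 K) ∈ v.asIdeal ∧
              ((2 ^ (j - c₂) : ℕ) : ℤ) • dat'.kolyvaginClass Nat.prime_two L ∉
                (W.baseChange K).torsionLocalKer (v.adicCompletion K) ((2 ^ L : ℕ) : ℤ))
    (hrel : L + c₀ ≤ 2 * (j - r * c₂)) :
    ∀ cc : ℕ, cc ≤ r → ∀ (T : Finset ℕ) (dat : KolyvaginHeegnerData Dt β ι (∏ p ∈ T, p)),
      T.card = r →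
      (∀ p ∈ T, Zhang2014.IsKolyvaginPrime (W.conductorNorm ℤ) W K 2 p ∧
        L + 1 ≤ Zhang2014.kolyvaginIndex W 2 p) →
      (∀ p ∈ T, p ∉ T₀ → I ≤ Zhang2014.kolyvaginIndex W 2 p) →
      (T ∩ T₀).card = cc →
      (∀ X' : Finset ℕ, ∃ q : ℕ, q ∉ X' ∧ Zhang2014.IsKolyvaginPrime (W.conductorNorm ℤ) W K 2 q ∧
        I ≤ Zhang2014.kolyvaginIndex W 2 q ∧
        ∃ v : HeightOneSpectrum (𝓞 K), ((q : ℕ) : 𝓞 K) ∈ v.asIdeal ∧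
          ((2 ^ (j - (r - cc) * c₂) : ℕ) : ℤ) • dat.kolyvaginClass Nat.prime_two L ∉
            (W.baseChange K).torsionLocalKer (v.adicCompletion K) ((2 ^ L : ℕ) : ℤ)) →
      ∃ (T' : Finset ℕ) (dat' : KolyvaginHeegnerData Dt β ι (∏ p ∈ T', p)),
        T'.card = r ∧
        (∀ p ∈ T', Zhang2014.IsKolyvaginPrime (W.conductorNorm ℤ) W K 2 p ∧
          I ≤ Zhang2014.kolyvaginIndex W 2 p) ∧
        (∀ X' : Finset ℕ, ∃ q : ℕ, q ∉ X' ∧ Zhang2014.IsKolyvaginPrime (W.conductorNorm ℤ) W K 2 q ∧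
          I ≤ Zhang2014.kolyvaginIndex W 2 q ∧
          ∃ v : HeightOneSpectrum (𝓞 K), ((q : ℕ) : 𝓞 K) ∈ v.asIdeal ∧
            ((2 ^ (j - r * c₂) : ℕ) : ℤ) • dat'.kolyvaginClass Nat.prime_two L ∉
              (W.baseChange K).torsionLocalKer (v.adicCompletion K) ((2 ^ L : ℕ) : ℤ)) := by
  intro cc
  induction cc with
  | zero =>
    intro _ T dat hcard hKol hfresh hc hBig
    refine ⟨T, dat, hcard, fun p hp ↦ ⟨(hKol p hp).1, hfresh p hp ?_⟩, ?_⟩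
    · intro hpT₀
      have : p ∈ T ∩ T₀ := Finset.mem_inter.mpr ⟨hp, hpT₀⟩
      rw [Finset.card_eq_zero] at hc
      simp [hc] at this
    · simpa only [Nat.sub_zero] using hBig
  | succ cc ih =>
    intro hcr T dat hcard hKol hfresh hc hBig
    -- an old prime `a ∈ T ∩ T₀` to drop
    obtain ⟨a, ha⟩ : (T ∩ T₀).Nonempty := by
      rw [← Finset.card_pos, hc]; exact Nat.succ_pos cc
    obtain ⟨haT, haT₀⟩ := Finset.mem_inter.mp ha
    -- the precondition of the swap at the current exponent
    have hrel' : L + c₀ ≤ 2 * (j - (r - (cc + 1)) * c₂) := by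
      have h1 : (r - (cc + 1)) * c₂ ≤ r * c₂ := Nat.mul_le_mul_right c₂ (Nat.sub_le r (cc + 1))
      omega
    -- SWAP at level `L`, the new prime outside `T ∪ T₀`
    obtain ⟨ℓ, hℓX, hℓT, hℓKol, hℓI, dat', hBig'⟩ :=
      hswap T a dat (j - (r - (cc + 1)) * c₂) (T ∪ T₀) hKol haT hrel' hBig
    have hℓT₀ : ℓ ∉ T₀ := fun h ↦ hℓX (Finset.mem_union_right _ h)
    have hexp : j - (r - (cc + 1)) * c₂ - c₂ = j - (r - cc) * c₂ := by
      have h1 : (r - cc) * c₂ = (r - (cc + 1)) * c₂ + c₂ := by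
        have : r - cc = (r - (cc + 1)) + 1 := by omega
        rw [this, Nat.add_mul, one_mul]
      omega
    refine ih (by omega) (insert ℓ (T.erase a)) dat' ?_ ?_ ?_ ?_ (by rw [← hexp]; exact hBig')
    · rw [Finset.card_insert_of_notMem (fun h ↦ hℓT (Finset.mem_of_mem_erase h)),
        Finset.card_erase_of_mem haT, hcard]
      omega
    · intro p hp
      rcases Finset.mem_insert.mp hp with rfl | hp'
      · exact ⟨hℓKol, by omega⟩
      · exact hKol p (Finset.mem_of_mem_erase hp')
    · intro p hp hpT₀
      rcases Finset.mem_insert.mp hp with rfl | hp'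
      · exact hℓI
      · exact hfresh p (Finset.mem_of_mem_erase hp') hpT₀
    · -- the number of old primes drops by one
      have h1 : insert ℓ (T.erase a) ∩ T₀ = (T ∩ T₀).erase a := by
        ext p
        simp only [Finset.mem_inter, Finset.mem_insert, Finset.mem_erase]
        constructor
        · rintro ⟨hp | ⟨hpa, hpT⟩, hpT₀⟩
          · exact absurd (hp ▸ hpT₀) hℓT₀
          · exact ⟨hpa, hpT, hpT₀⟩
        · rintro ⟨hpa, hpT, hpT₀⟩
          exact ⟨Or.inr ⟨hpa, hpT⟩, hpT₀⟩
      rw [h1, Finset.card_erase_of_mem ha, hc]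
      omega

end Walk

/-! ## U2 from the lossy swap -/

/-- **U2 `FullClassDeepeningAtTwo` (stmt-BirchSwinnertonDyer-28084, the ROUTE decl) from the LOSSY prime swap S1L**
(`hS1L` = the text of the registered-to-be stub `stub_primeSwapAtTwoLossy` VERBATIM; everything else landed: S2
`stub_chebotarevOneClassIndexAtTwo`, the level-down identity, the seed walk). Constant: `c := c₀ + 2c₁ + 2c₂ + 3`; new level
`M' := M − 1`; new primes of index `≥ θ (M−1) + k + M`. CONDITIONAL on `hS1L` (D-0014).
[cite: Kolyvagin1991MathAnn, §2, p. 257 (propagation, Prop. 8 of [1])] [cite: McCallumLMS1991, §5 Prop. 5.2]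
[cite: WZhang2014, Lemma 8.4] -/
theorem fullClassDeepeningAtTwo_of_lossySwap
    (hS1L :
    ∀ (W : WeierstrassCurve ℚ) [W.IsElliptic] [W.IsGloballyMinimal], ¬ W.HasCM →
      (Rank1Residual.GoodOrd W 2 ∨ Rank1Residual.Mult W 2) →
      (∀ m : ℕ, W.HasSurjectiveModNGaloisRep (2 ^ m : ℕ)) →
      ∀ (K : Type) [Field K] [NumberField K], IsImaginaryQuadratic K → NumberField.discr K ≠ -3 →
      NumberField.discr K ≠ -4 → ¬ ((2 : ℤ) ∣ NumberField.discr K) → ∀ [NeZero (W.conductorNorm ℤ)],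
      SatisfiesHeegnerHypothesis (W.conductorNorm ℤ) K →
      ∃ c₀ c₂ : ℕ, ∀ (Dt : ModularParametrizationData W (W.conductorNorm ℤ)) (β : ℤ) (ι : K →+* ℂ),
        ∀ (M I : ℕ) (T : Finset ℕ) (a : ℕ)
          (dat : KolyvaginHeegnerData Dt β ι (∏ p ∈ T, p)) (j : ℕ) (X : Finset ℕ),
          1 ≤ M → M + 1 ≤ I →
          (∀ p ∈ T, Zhang2014.IsKolyvaginPrime (W.conductorNorm ℤ) W K 2 p ∧
            M + 1 ≤ Zhang2014.kolyvaginIndex W 2 p) →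
          a ∈ T → M + c₀ ≤ 2 * j →
          (∀ X' : Finset ℕ, ∃ q : ℕ, q ∉ X' ∧ Zhang2014.IsKolyvaginPrime (W.conductorNorm ℤ) W K 2 q ∧
            I ≤ Zhang2014.kolyvaginIndex W 2 q ∧
            ∃ v : HeightOneSpectrum (𝓞 K), ((q : ℕ) : 𝓞 K) ∈ v.asIdeal ∧
              ((2 ^ j : ℕ) : ℤ) • dat.kolyvaginClass Nat.prime_two M ∉
                (W.baseChange K).torsionLocalKer (v.adicCompletion K) ((2 ^ M : ℕ) : ℤ)) →
          ∃ ℓ : ℕ, ℓ ∉ X ∧ ℓ ∉ T ∧ Zhang2014.IsKolyvaginPrime (W.conductorNorm ℤ) W K 2 ℓ ∧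
            I ≤ Zhang2014.kolyvaginIndex W 2 ℓ ∧
            (∃ v : HeightOneSpectrum (𝓞 K), ((ℓ : ℕ) : 𝓞 K) ∈ v.asIdeal ∧
              ((2 ^ (j - c₂) : ℕ) : ℤ) • dat.kolyvaginClass Nat.prime_two M ∉
                (W.baseChange K).torsionLocalKer (v.adicCompletion K) ((2 ^ M : ℕ) : ℤ)) ∧
            ∃ dat' : KolyvaginHeegnerData Dt β ι (∏ p ∈ insert ℓ (T.erase a), p),
              (∀ X' : Finset ℕ, ∃ q : ℕ, q ∉ X' ∧ Zhang2014.IsKolyvaginPrime (W.conductorNorm ℤ) W K 2 q ∧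
                I ≤ Zhang2014.kolyvaginIndex W 2 q ∧
                ∃ v : HeightOneSpectrum (𝓞 K), ((q : ℕ) : 𝓞 K) ∈ v.asIdeal ∧
                  ((2 ^ (j - c₂) : ℕ) : ℤ) • dat'.kolyvaginClass Nat.prime_two M ∉
                    (W.baseChange K).torsionLocalKer (v.adicCompletion K) ((2 ^ M : ℕ) : ℤ))) :
    FullClassDeepeningAtTwo := by
  intro W _ _ hCM hred hsur K _ _ hK _ hHN hodd hne3 htor hH2 Dt β ι hβ
  set N := W.conductorNorm ℤ with hN
  -- the habitat in S1L's spelling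
  have h2d : ¬ ((2 : ℤ) ∣ NumberField.discr K) := fun h ↦
    (Int.not_even_iff_odd.mpr hodd) (even_iff_two_dvd.mpr h)
  have hne4 : NumberField.discr K ≠ -4 := fun h ↦ h2d (by rw [h]; norm_num)
  obtain ⟨c₀, c₂, hS1⟩ := hS1L W hCM hred hsur K hK hne3 hne4 h2d hHN
  obtain ⟨c₁, hS2⟩ := stub_chebotarevOneClassIndexAtTwo W hCM hred hsur K hK hne3 hne4 h2d hHN
  refine ⟨c₀ + 2 * c₁ + 2 * c₂ + 3, ?_⟩
  intro θ k r m M n d hn hcard hlev hcM hne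
  -- sizes
  have hc2 : 2 * m + 2 * c₂ * r + (c₀ + 2 * c₁ + 3) ≤ M := by
    have h1 : 2 * m ≤ (c₀ + 2 * c₁ + 2 * c₂ + 3) * m := Nat.mul_le_mul_right m (by omega)
    have h2 : 2 * c₂ * r ≤ (c₀ + 2 * c₁ + 2 * c₂ + 3) * r := Nat.mul_le_mul_right r (by omega)
    have h3 : (c₀ + 2 * c₁ + 2 * c₂ + 3) * (m + r + 1) =
        (c₀ + 2 * c₁ + 2 * c₂ + 3) * m + (c₀ + 2 * c₁ + 2 * c₂ + 3) * r + (c₀ + 2 * c₁ + 2 * c₂ + 3) := by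
      ring
    omega
  -- the level one step down and the exponents
  set L : ℕ := M - 1
  have hL1 : 1 ≤ L := by omega
  have hLM : L ≤ M := Nat.sub_le M 1
  have hM1 : 1 ≤ M := by omega
  set j : ℕ := M - m - 2 - c₁ with hj
  have hrel : L + c₀ ≤ 2 * (j - r * c₂) := by
    have : 2 * c₂ * r = 2 * (r * c₂) := by ring
    omega
  -- fullness one level down: `2^(M-m-2) c_L(n) ≠ 0`
  have hneL : ((2 ^ (M - m - 2) : ℕ) : ℤ) • d.kolyvaginClass Nat.prime_two L ≠ 0 := by
    have hMm : M - m - 1 = (M - m - 2) + 1 := by omega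
    have hne' : ((2 ^ ((M - m - 2) + 1) : ℕ) : ℤ) • d.kolyvaginClass Nat.prime_two M ≠ 0 := by
      rw [← hMm]; exact_mod_cast hne
    exact pow_smul_kolyvaginClass_pred_ne_zero W hsur K hK hne3 hne4 hodd hHN Dt β ι d hn hM1 hlev hne'
  -- the index of the fresh primes
  set I : ℕ := θ * L + k + L + 1 with hI
  have hLI : L + 1 ≤ I := by omega
  have hlevL : ((L : ℕ) : ℕ∞) ≤ Zhang2014.levelIndex W 2 n := le_trans (by exact_mod_cast hLM) hlev
  -- local largeness of `c_L(n)` at fresh primes of index `≥ I` (S2, Čebotarev with index)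
  have hBig0 : ∀ X' : Finset ℕ, ∃ q : ℕ, q ∉ X' ∧ Zhang2014.IsKolyvaginPrime N W K 2 q ∧
      I ≤ Zhang2014.kolyvaginIndex W 2 q ∧
      ∃ v : HeightOneSpectrum (𝓞 K), ((q : ℕ) : 𝓞 K) ∈ v.asIdeal ∧
        ((2 ^ j : ℕ) : ℤ) • d.kolyvaginClass Nat.prime_two L ∉
          (W.baseChange K).torsionLocalKer (v.adicCompletion K) ((2 ^ L : ℕ) : ℤ) := by
    intro X'
    obtain ⟨q, hqX, hqKol, hqI, v, hv, hloc⟩ :=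
      hS2 Dt β ι n d L (M - m - 2) I hn hL1 hlevL (by omega) (by omega) hneL X'
    exact ⟨q, hqX, hqKol, hqI, v, hv, by simpa only [hj] using hloc⟩
  -- the seed window `T₀ = primes of n` (transport `d` along `∏ T₀ = n`)
  set T₀ : Finset ℕ := n.primeFactors with hT₀
  have hT₀prime : ∀ p ∈ T₀, p.Prime := fun p hp ↦ Nat.prime_of_mem_primeFactors hp
  have hprod₀ : ∏ p ∈ T₀, p = n := Nat.prod_primeFactors_of_squarefree hn.1
  let d₀ : KolyvaginHeegnerData Dt β ι (∏ p ∈ T₀, p) := hprod₀.symm ▸ d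
  have hcl : ∀ M' : ℕ, d₀.kolyvaginClass Nat.prime_two M' = d.kolyvaginClass Nat.prime_two M' :=
    fun M' ↦ kolyvaginClass_cast₂ hprod₀.symm d M'
  have hT₀Kol : ∀ p ∈ T₀, Zhang2014.IsKolyvaginPrime N W K 2 p ∧ L + 1 ≤ Zhang2014.kolyvaginIndex W 2 p := by
    intro p hp
    refine ⟨hn.2 p hp, ?_⟩
    have h := (Zhang2014.natCast_le_levelIndex_iff.mp hlev) p hp
    omega
  -- the walk: `r` lossy swaps at level `L`
  obtain ⟨T', dat', hT'card, hT'Kol, hBig'⟩ :=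
    seedWalk W K Dt β ι c₀ c₂ L I j r T₀ hLI
      (fun T a dat j X hKol haT hrelj hBig ↦ by
        obtain ⟨ℓ, hℓX, hℓT, hℓKol, hℓI, -, dat', hBig'⟩ := hS1 Dt β ι L I T a dat j X hL1 hLI hKol haT hrelj hBig
        exact ⟨ℓ, hℓX, hℓT, hℓKol, hℓI, dat', hBig'⟩)
      hrel r le_rfl T₀ d₀ (by rw [hT₀, hcard]) hT₀Kol (fun p hp hpT₀ ↦ absurd hp hpT₀)
      (by rw [Finset.inter_self, hT₀, hcard])
      (fun X' ↦ by
        obtain ⟨q, hqX, hqKol, hqI, v, hv, hloc⟩ := hBig0 X'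
        refine ⟨q, hqX, hqKol, hqI, v, hv, ?_⟩
        rw [hcl, Nat.sub_self, Nat.zero_mul, Nat.sub_zero]
        exact hloc)
  -- read off the conclusion at level `M' := L` on the conductor `n' := ∏ T'`
  have hT'prime : ∀ p ∈ T', p.Prime := fun p hp ↦ (hT'Kol p hp).1.1
  refine ⟨∏ p ∈ T', p, dat', L, ⟨squarefree_prod_primes₂ hT'prime, fun p hp ↦
    (hT'Kol p (by rwa [primeFactors_prod_primes₂ hT'prime] at hp)).1⟩, ?_, hL1, ?_, ?_⟩
  · rw [primeFactors_prod_primes₂ hT'prime, hT'card]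
  · rw [Zhang2014.natCast_le_levelIndex_iff]
    intro p hp
    rw [primeFactors_prod_primes₂ hT'prime] at hp
    have := (hT'Kol p hp).2
    have hθ : θ * L + k ≤ I := by omega
    omega
  · obtain ⟨q, -, -, -, v, -, hloc⟩ := hBig' ∅
    intro h0
    exact hloc (by rw [h0, zsmul_zero]; exact zero_mem _)

end Summit.BirchSwinnertonDyer.BirchSwinnertonDyer.Theorems.KolyvaginLowerBoundAtTwo

end
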